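import Summits.KontsevichZagierPeriods.KontsevichZagierPeriods.Theorems.MultiplicationThree.Negative.Pinned
import Literature.NumberTheory.Transcendental.KZDominatedFamilyRelations
import Literature.NumberTheory.Transcendental.KZSubcalculusInvariants
import Literature.MeasureTheory.Lebesgue.PolynomialZeroSet

/-!
# `SimplexToMaxCell` (stmt-KontsevichZagierPeriods-14676, route TerasomaMultiplication)

Step (iii)(d) of the Bolza line for crux `MultiplicationThree`: for every rational `s > 0` the
Dirichlet simplex representation `[Δ, g]`, `Δ = {σ₁, σ₂ > 0, σ₁ + σ₂ < 3}`,
`g = (σ₁σ₂σ₃)^(s-1)`, `σ₃ = 3 − σ₁ − σ₂`, is KZ-equivalent to `[M₃, 3g]`, where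
`M₃ = {σ₃ > σ₁, σ₃ > σ₂}` is the cell on which `σ₃` is the largest coordinate.

The chain of moves (Kontsevich–Zagier 2001, §1.2, rules (1a), (1b), (2) only):

* `Δ = M₁ ∪ M₂ ∪ M₃ ∪ N`, `Mᵢ = {σᵢ strictly largest}`, `N ⊆ {σ₁ = σ₂} ∪ {σ₁ = σ₃} ∪ {σ₂ = σ₃}`
  contained in the zero set of one nonzero polynomial, hence Lebesgue-null
  (`MvPolynomial.volume_zeroSet_eq_zero`): `[Δ, g] ∼ [M₁ ∪ M₂ ∪ M₃, g]`
  (`KZ.IntegralRep.of_sub_of_restrict_mem_relations`) `∼ [M₁,g] + [M₂,g] + [M₃,g]` (rule (1a) twice,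
  the cells being pairwise disjoint);
* the CYCLIC affine map `c(σ₁, σ₂) = (σ₂, 3 − σ₁ − σ₂)` (the order-3 symmetry of the simplex,
  `|det Dc| = 1`, `g ∘ c = g`) maps `M₂` onto `M₁` and `M₁` onto `M₃`: two rule-(2) moves
  `[M₂, g] ∼ [M₁, g]`, `[M₁, g] ∼ [M₃, g]`;
* `[M₃, 3g] ∼ 3•[M₃, g]` is integrand additivity
  (`KZ.IntegralRep.of_constMul_nat_sub_nsmul_mem_relations`).

Arbitrary representations `r`, `r'` with the pinned domains/integrands differ from the two used
here (`MultiplicationThreeNegative.simplexRep s hs` and a scaled restriction of it) by congruences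
(`KZ.of_sub_of_mem_relations_of_eqOn`). Pure proof file: no definitions are introduced — the three
cells, the cyclic map and its (constant) derivative are written out.

References: M. Kontsevich, D. Zagier, *Periods* (2001), §1.2; G. Andrews, R. Askey, R. Roy,
*Special Functions* (1999), §1.8 (Dirichlet's simplex integral).
-/

noncomputable section

open MeasureTheory Set Real
open scoped BigOperators

namespace Summit.KontsevichZagierPeriods.TerasomaMultiplication.SimplexToMaxCell

open Literature.NumberTheory.Transcendental
open Literature.NumberTheory.Transcendental.KZ
open Literature.ModelTheory.ExponentialFields (IsSemialgebraic)
open MvPolynomial (aeval X C)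
open Summit.KontsevichZagierPeriods.KontsevichZagierPeriods.Theses.TerasomaMultiplication
  (SimplexToMaxCell)
open Summit.KontsevichZagierPeriods.TerasomaMultiplication.MultiplicationThreeNegative

/-! ## The three cells

`M₁ = {x | 0 < x 1 ∧ 0 < 3 - x 0 - x 1 ∧ x 1 < x 0 ∧ 3 - x 0 - x 1 < x 0}` (`σ₁` largest),
`M₂ = {x | 0 < 3 - x 0 - x 1 ∧ 0 < x 0 ∧ 3 - x 0 - x 1 < x 1 ∧ x 0 < x 1}` (`σ₂` largest),
`M₃ = {x | 0 < x 0 ∧ 0 < x 1 ∧ x 0 < 3 - x 0 - x 1 ∧ x 1 < 3 - x 0 - x 1}` (`σ₃` largest, literally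
the domain clause of the item). -/

/-- `aeval x 3 = 3` for the constant polynomial `3` in two variables. [folklore] -/
theorem aeval_three (x : Fin 2 → ℝ) : aeval x (3 : MvPolynomial (Fin 2) ℚ) = (3 : ℝ) := by
  rw [show (3 : MvPolynomial (Fin 2) ℚ) = C 3 by simp [map_ofNat], MvPolynomial.aeval_C]; simp

/-- The cell `M₃` (`σ₃` largest) is `ℚ`-semialgebraic. [folklore] -/
theorem isSemialgebraic_cellThree :
    IsSemialgebraic ℚ {x : Fin 2 → ℝ | 0 < x 0 ∧ 0 < x 1 ∧ x 0 < 3 - x 0 - x 1 ∧ x 1 < 3 - x 0 - x 1} := by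
  have h : {x : Fin 2 → ℝ | 0 < x 0 ∧ 0 < x 1 ∧ x 0 < 3 - x 0 - x 1 ∧ x 1 < 3 - x 0 - x 1} =
      {x | ∀ l, 0 < aeval x ((![X 0, X 1, 3 - X 0 - X 1 - X 0, 3 - X 0 - X 1 - X 1] :
        Fin 4 → MvPolynomial (Fin 2) ℚ) l)} := by
    ext x
    simp only [mem_setOf_eq, Fin.forall_fin_succ, IsEmpty.forall_iff, Matrix.cons_val_zero,
      Matrix.cons_val_succ, map_sub, MvPolynomial.aeval_X, aeval_three, and_true]
    constructor
    · rintro ⟨h0, h1, h2, h3⟩; exact ⟨h0, h1, by linarith, by linarith⟩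
    · rintro ⟨h0, h1, h2, h3⟩; exact ⟨h0, h1, by linarith, by linarith⟩
  rw [h]
  exact isSemialgebraic_setOf_forall_aeval_pos _

/-- The cell `M₁` (`σ₁` largest) is `ℚ`-semialgebraic. [folklore] -/
theorem isSemialgebraic_cellOne :
    IsSemialgebraic ℚ {x : Fin 2 → ℝ | 0 < x 1 ∧ 0 < 3 - x 0 - x 1 ∧ x 1 < x 0 ∧ 3 - x 0 - x 1 < x 0} := by
  have h : {x : Fin 2 → ℝ | 0 < x 1 ∧ 0 < 3 - x 0 - x 1 ∧ x 1 < x 0 ∧ 3 - x 0 - x 1 < x 0} =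
      {x | ∀ l, 0 < aeval x ((![X 1, 3 - X 0 - X 1, X 0 - X 1, X 0 - (3 - X 0 - X 1)] :
        Fin 4 → MvPolynomial (Fin 2) ℚ) l)} := by
    ext x
    simp only [mem_setOf_eq, Fin.forall_fin_succ, IsEmpty.forall_iff, Matrix.cons_val_zero,
      Matrix.cons_val_succ, map_sub, MvPolynomial.aeval_X, aeval_three, and_true]
    constructor
    · rintro ⟨h0, h1, h2, h3⟩; exact ⟨h0, by linarith, by linarith, by linarith⟩
    · rintro ⟨h0, h1, h2, h3⟩; exact ⟨h0, by linarith, by linarith, by linarith⟩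
  rw [h]
  exact isSemialgebraic_setOf_forall_aeval_pos _

/-- The cell `M₂` (`σ₂` largest) is `ℚ`-semialgebraic. [folklore] -/
theorem isSemialgebraic_cellTwo :
    IsSemialgebraic ℚ {x : Fin 2 → ℝ | 0 < 3 - x 0 - x 1 ∧ 0 < x 0 ∧ 3 - x 0 - x 1 < x 1 ∧ x 0 < x 1} := by
  have h : {x : Fin 2 → ℝ | 0 < 3 - x 0 - x 1 ∧ 0 < x 0 ∧ 3 - x 0 - x 1 < x 1 ∧ x 0 < x 1} =
      {x | ∀ l, 0 < aeval x ((![3 - X 0 - X 1, X 0, X 1 - (3 - X 0 - X 1), X 1 - X 0] :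
        Fin 4 → MvPolynomial (Fin 2) ℚ) l)} := by
    ext x
    simp only [mem_setOf_eq, Fin.forall_fin_succ, IsEmpty.forall_iff, Matrix.cons_val_zero,
      Matrix.cons_val_succ, map_sub, MvPolynomial.aeval_X, aeval_three, and_true]
    constructor
    · rintro ⟨h0, h1, h2, h3⟩; exact ⟨by linarith, h1, by linarith, by linarith⟩
    · rintro ⟨h0, h1, h2, h3⟩; exact ⟨by linarith, h1, by linarith, by linarith⟩
  rw [h]
  exact isSemialgebraic_setOf_forall_aeval_pos _

/-- The three cells lie in the triangle. [folklore] -/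
theorem cells_subset_triangle :
    {x : Fin 2 → ℝ | 0 < x 1 ∧ 0 < 3 - x 0 - x 1 ∧ x 1 < x 0 ∧ 3 - x 0 - x 1 < x 0} ∪
      ({x : Fin 2 → ℝ | 0 < 3 - x 0 - x 1 ∧ 0 < x 0 ∧ 3 - x 0 - x 1 < x 1 ∧ x 0 < x 1} ∪
        {x : Fin 2 → ℝ | 0 < x 0 ∧ 0 < x 1 ∧ x 0 < 3 - x 0 - x 1 ∧ x 1 < 3 - x 0 - x 1}) ⊆
      triangle := by
  rintro x (⟨h0, h1, h2, h3⟩ | ⟨h0, h1, h2, h3⟩ | ⟨h0, h1, h2, h3⟩)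
  · exact ⟨by linarith, h0, by linarith⟩
  · exact ⟨h1, by linarith, by linarith⟩
  · exact ⟨h0, h1, by linarith⟩

/-- **The complement of the three cells in the triangle is Lebesgue-null**: it lies on the three
mirror lines `σ₁ = σ₂`, `σ₁ = σ₃`, `σ₂ = σ₃`, i.e. in the zero set of the nonzero polynomial
`(X₀ − X₁)(2X₀ + X₁ − 3)(X₀ + 2X₁ − 3)`. [folklore] -/
theorem volume_triangle_diff_cells :
    volume (triangle \ ({x : Fin 2 → ℝ | 0 < x 1 ∧ 0 < 3 - x 0 - x 1 ∧ x 1 < x 0 ∧ 3 - x 0 - x 1 < x 0} ∪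
      ({x : Fin 2 → ℝ | 0 < 3 - x 0 - x 1 ∧ 0 < x 0 ∧ 3 - x 0 - x 1 < x 1 ∧ x 0 < x 1} ∪
        {x : Fin 2 → ℝ | 0 < x 0 ∧ 0 < x 1 ∧ x 0 < 3 - x 0 - x 1 ∧ x 1 < 3 - x 0 - x 1}))) = 0 := by
  have hp : ((X 0 - X 1) * (2 * X 0 + X 1 - C 3) * (X 0 + 2 * X 1 - C 3) :
      MvPolynomial (Fin 2) ℝ) ≠ 0 := by
    intro h
    have := congrArg (MvPolynomial.eval ![(0:ℝ), 1]) h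
    simp only [map_mul, map_sub, map_add, MvPolynomial.eval_X, map_ofNat, Matrix.cons_val_zero,
      Matrix.cons_val_one, map_zero] at this
    norm_num at this
  refine measure_mono_null (fun x hx => ?_) (MvPolynomial.volume_zeroSet_eq_zero 2 _ hp)
  obtain ⟨⟨h0, h1, h2⟩, hx⟩ := hx
  simp only [mem_union, mem_setOf_eq, not_or] at hx
  obtain ⟨hx1, hx2, hx3⟩ := hx
  show MvPolynomial.eval x ((X 0 - X 1) * (2 * X 0 + X 1 - C 3) * (X 0 + 2 * X 1 - C 3)) = 0
  simp only [map_mul, map_sub, map_add, MvPolynomial.eval_X, map_ofNat]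
  by_contra hne
  simp only [mul_eq_zero, not_or] at hne
  obtain ⟨⟨ha, hb⟩, hc⟩ := hne
  rcases lt_or_gt_of_ne (show x 0 ≠ x 1 from fun h => ha (by rw [h, sub_self])) with ha | ha <;>
  rcases lt_or_gt_of_ne (show x 0 ≠ 3 - x 0 - x 1 from fun h => hb (by linarith)) with hb | hb <;>
  rcases lt_or_gt_of_ne (show x 1 ≠ 3 - x 0 - x 1 from fun h => hc (by linarith)) with hc | hc <;>
  first
    | exact hx3 ⟨h0, h1, hb, hc⟩
    | exact hx2 ⟨by linarith, h0, hc, ha⟩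
    | exact hx1 ⟨h1, by linarith, ha, hb⟩
    | linarith

/-! ## The cyclic map `c(σ₁, σ₂) = (σ₂, 3 − σ₁ − σ₂)` -/

/-- The derivative of the cyclic map, first component: `Dc v 0 = v 1`. [folklore] -/
theorem cycD_apply_zero (v : Fin 2 → ℝ) :
    LinearMap.toContinuousLinearMap (Matrix.toLin' !![(0:ℝ), 1; -1, -1]) v 0 = v 1 := by
  change Matrix.toLin' !![(0:ℝ), 1; -1, -1] v 0 = _
  rw [Matrix.toLin'_apply]
  simp [Matrix.mulVec, dotProduct, Fin.sum_univ_two]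

/-- The derivative of the cyclic map, second component: `Dc v 1 = -v 0 - v 1`. [folklore] -/
theorem cycD_apply_one (v : Fin 2 → ℝ) :
    LinearMap.toContinuousLinearMap (Matrix.toLin' !![(0:ℝ), 1; -1, -1]) v 1 = -v 0 - v 1 := by
  change Matrix.toLin' !![(0:ℝ), 1; -1, -1] v 1 = _
  rw [Matrix.toLin'_apply]
  simp [Matrix.mulVec, dotProduct, Fin.sum_univ_two]
  ring

/-- `det Dc = 1`. [folklore] -/
theorem det_cycD : (LinearMap.toContinuousLinearMap (Matrix.toLin' !![(0:ℝ), 1; -1, -1])).det = 1 := by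
  change LinearMap.det (Matrix.toLin' !![(0:ℝ), 1; -1, -1]) = _
  rw [LinearMap.det_toLin', Matrix.det_fin_two_of]
  norm_num

/-- The cyclic map is differentiable everywhere with (constant) derivative `Dc`. [folklore] -/
theorem hasFDerivAt_cyc (x : Fin 2 → ℝ) :
    HasFDerivAt (fun y : Fin 2 → ℝ => (![y 1, 3 - y 0 - y 1] : Fin 2 → ℝ))
      (LinearMap.toContinuousLinearMap (Matrix.toLin' !![(0:ℝ), 1; -1, -1])) x := by
  have h0 : HasFDerivAt (fun y : Fin 2 → ℝ => y 0)
      (ContinuousLinearMap.proj (R := ℝ) (φ := fun _ : Fin 2 => ℝ) 0) x := hasFDerivAt_apply 0 x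
  have h1 : HasFDerivAt (fun y : Fin 2 → ℝ => y 1)
      (ContinuousLinearMap.proj (R := ℝ) (φ := fun _ : Fin 2 => ℝ) 1) x := hasFDerivAt_apply 1 x
  rw [hasFDerivAt_pi']
  refine Fin.forall_fin_two.mpr ⟨?_, ?_⟩
  · have hf : (fun y : Fin 2 → ℝ => (![y 1, 3 - y 0 - y 1] : Fin 2 → ℝ) 0) = fun y => y 1 :=
      funext fun y => rfl
    rw [hf]
    refine h1.congr_fderiv (ContinuousLinearMap.ext fun v => ?_)
    show v 1 = (LinearMap.toContinuousLinearMap (Matrix.toLin' !![(0:ℝ), 1; -1, -1])) v 0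
    rw [cycD_apply_zero]
  · have hf : (fun y : Fin 2 → ℝ => (![y 1, 3 - y 0 - y 1] : Fin 2 → ℝ) 1) =
        fun y => 3 - y 0 - y 1 := funext fun y => rfl
    rw [hf]
    refine ((h0.const_sub 3).sub h1).congr_fderiv (ContinuousLinearMap.ext fun v => ?_)
    show -v 0 - v 1 = (LinearMap.toContinuousLinearMap (Matrix.toLin' !![(0:ℝ), 1; -1, -1])) v 1
    rw [cycD_apply_one]

/-- The cyclic map is injective. [folklore] -/
theorem cyc_injective :
    Function.Injective (fun y : Fin 2 → ℝ => (![y 1, 3 - y 0 - y 1] : Fin 2 → ℝ)) := by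
  intro x y hxy
  have e0 := congrFun hxy 0
  have e1 := congrFun hxy 1
  simp only [Matrix.cons_val_zero, Matrix.cons_val_one] at e0 e1
  funext i
  fin_cases i
  · show x 0 = y 0
    linarith
  · exact e0

/-- The cyclic map is a `ℚ`-semialgebraic (indeed polynomial) map on every `ℚ`-semialgebraic set.
[folklore] -/
theorem isSemialgebraicMapOn_cyc {σ : Set (Fin 2 → ℝ)} (hσ : IsSemialgebraic ℚ σ) :
    IsSemialgebraicMapOn ℚ σ (fun y : Fin 2 → ℝ => (![y 1, 3 - y 0 - y 1] : Fin 2 → ℝ)) := by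
  refine (isSemialgebraicMapOn_aeval hσ (![X 1, 3 - X 0 - X 1] : Fin 2 → MvPolynomial (Fin 2) ℚ)).congr
    fun x _ => ?_
  funext j
  fin_cases j
  · simp
  · simp

/-- The simplex integrand `g = (σ₁σ₂σ₃)^(s-1)` is invariant under the cyclic map. [folklore] -/
theorem simplexFun_cyc (s : ℚ) (x : Fin 2 → ℝ) :
    simplexFun s (![x 1, 3 - x 0 - x 1]) = simplexFun s x := by
  simp only [simplexFun, Matrix.cons_val_zero, Matrix.cons_val_one]
  congr 1
  ring

/-- The cyclic map sends `M₁` (`σ₁` largest) ONTO `M₃` (`σ₃` largest). [folklore] -/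
theorem image_cyc_cellOne :
    (fun y : Fin 2 → ℝ => (![y 1, 3 - y 0 - y 1] : Fin 2 → ℝ)) ''
        {x : Fin 2 → ℝ | 0 < x 1 ∧ 0 < 3 - x 0 - x 1 ∧ x 1 < x 0 ∧ 3 - x 0 - x 1 < x 0} =
      {x : Fin 2 → ℝ | 0 < x 0 ∧ 0 < x 1 ∧ x 0 < 3 - x 0 - x 1 ∧ x 1 < 3 - x 0 - x 1} := by
  ext y
  constructor
  · rintro ⟨x, ⟨h0, h1, h2, h3⟩, rfl⟩
    simp only [mem_setOf_eq, Matrix.cons_val_zero, Matrix.cons_val_one]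
    exact ⟨h0, h1, by linarith, by linarith⟩
  · rintro ⟨h0, h1, h2, h3⟩
    refine ⟨![3 - y 0 - y 1, y 0], ?_, ?_⟩
    · simp only [mem_setOf_eq, Matrix.cons_val_zero, Matrix.cons_val_one]
      exact ⟨h0, by linarith, h2, by linarith⟩
    · funext i
      fin_cases i
      · rfl
      · show 3 - (3 - y 0 - y 1) - y 0 = y 1
        ring

/-- The cyclic map sends `M₂` (`σ₂` largest) ONTO `M₁` (`σ₁` largest). [folklore] -/
theorem image_cyc_cellTwo :
    (fun y : Fin 2 → ℝ => (![y 1, 3 - y 0 - y 1] : Fin 2 → ℝ)) ''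
        {x : Fin 2 → ℝ | 0 < 3 - x 0 - x 1 ∧ 0 < x 0 ∧ 3 - x 0 - x 1 < x 1 ∧ x 0 < x 1} =
      {x : Fin 2 → ℝ | 0 < x 1 ∧ 0 < 3 - x 0 - x 1 ∧ x 1 < x 0 ∧ 3 - x 0 - x 1 < x 0} := by
  ext y
  constructor
  · rintro ⟨x, ⟨h0, h1, h2, h3⟩, rfl⟩
    simp only [mem_setOf_eq, Matrix.cons_val_zero, Matrix.cons_val_one]
    exact ⟨h0, by linarith, h2, by linarith⟩
  · rintro ⟨h0, h1, h2, h3⟩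
    refine ⟨![3 - y 0 - y 1, y 0], ?_, ?_⟩
    · simp only [mem_setOf_eq, Matrix.cons_val_zero, Matrix.cons_val_one]
      exact ⟨by linarith, h1, by linarith, by linarith⟩
    · funext i
      fin_cases i
      · rfl
      · show 3 - (3 - y 0 - y 1) - y 0 = y 1
        ring

/-- **One rule-(2) move by the cyclic map**: if `c` maps a semialgebraic `A ⊆ Δ` onto `B ⊆ Δ`, then
`[A, g] − [B, g] ∈ changeOfVariablesRel` (`|det Dc| = 1`, `g ∘ c = g`).
[cite: KontsevichZagier2001, §1.2 rule (2)] -/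
theorem of_restrict_sub_of_restrict_mem_changeOfVariablesRel {s : ℚ} (hs : 0 < s)
    {A B : Set (Fin 2 → ℝ)} (hA : IsSemialgebraic ℚ A) (hAt : A ⊆ triangle)
    (hB : IsSemialgebraic ℚ B) (hBt : B ⊆ triangle)
    (hAB : (fun y : Fin 2 → ℝ => (![y 1, 3 - y 0 - y 1] : Fin 2 → ℝ)) '' A = B) :
    of ((simplexRep s hs).restrict A hA hAt) - of ((simplexRep s hs).restrict B hB hBt) ∈
      changeOfVariablesRel := by
  refine ⟨2, (simplexRep s hs).restrict A hA hAt, (simplexRep s hs).restrict B hB hBt,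
    fun y : Fin 2 → ℝ => (![y 1, 3 - y 0 - y 1] : Fin 2 → ℝ),
    fun _ => LinearMap.toContinuousLinearMap (Matrix.toLin' !![(0:ℝ), 1; -1, -1]),
    isSemialgebraicMapOn_cyc hA, fun x _ => (hasFDerivAt_cyc x).hasFDerivWithinAt,
    cyc_injective.injOn, hAB.symm, fun x _ => ?_, rfl⟩
  show simplexFun s x = simplexFun s (![x 1, 3 - x 0 - x 1]) * |(LinearMap.toContinuousLinearMap
    (Matrix.toLin' !![(0:ℝ), 1; -1, -1])).det|
  rw [det_cycD, abs_one, mul_one, simplexFun_cyc]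

/-! ## Bookkeeping and the theorem -/

/-- The six moves of the chain combine to `[R] − [R₃']`. [folklore] -/
theorem mem_of_chain {G : Type*} [AddCommGroup G] (H : AddSubgroup G) {R RE R₁ R₂₃ R₂ R₃ R₃' : G}
    (e1 : R - RE ∈ H) (e2 : RE - R₁ - R₂₃ ∈ H) (e3 : R₂₃ - R₂ - R₃ ∈ H) (e4 : R₂ - R₁ ∈ H)
    (e5 : R₁ - R₃ ∈ H) (e6 : R₃' - 3 • R₃ ∈ H) : R - R₃' ∈ H := by
  have key : R - R₃' = (R - RE) + (RE - R₁ - R₂₃) + (R₂₃ - R₂ - R₃) + (R₂ - R₁) + (R₁ - R₃) +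
      (R₁ - R₃) - (R₃' - 3 • R₃) := by
    abel
  rw [key]
  exact H.sub_mem (H.add_mem (H.add_mem (H.add_mem (H.add_mem (H.add_mem e1 e2) e3) e4) e5) e5) e6

/-- **`SimplexToMaxCell`** (item stmt-KontsevichZagierPeriods-14676): for every rational `s > 0`,
`[Δ, (σ₁σ₂σ₃)^(s-1)] ∼ [M₃, 3(σ₁σ₂σ₃)^(s-1)]` in the Kontsevich–Zagier calculus, by two domain
additivities (plus a null set), two changes of variables along the cyclic symmetry of the simplex,
and integrand additivity. [cite: KontsevichZagier2001, §1.2] -/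
theorem simplexToMaxCell_proof : SimplexToMaxCell := by
  intro s hs r r' hr hri hr' hri'
  -- the three cells and their union
  have h1 := isSemialgebraic_cellOne
  have h2 := isSemialgebraic_cellTwo
  have h3 := isSemialgebraic_cellThree
  have h23 := h2.union h3
  have hE := h1.union h23
  have hEt := cells_subset_triangle
  have h1t : {x : Fin 2 → ℝ | 0 < x 1 ∧ 0 < 3 - x 0 - x 1 ∧ x 1 < x 0 ∧ 3 - x 0 - x 1 < x 0} ⊆
      triangle := fun x hx => hEt (Or.inl hx)
  have h23t : {x : Fin 2 → ℝ | 0 < 3 - x 0 - x 1 ∧ 0 < x 0 ∧ 3 - x 0 - x 1 < x 1 ∧ x 0 < x 1} ∪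
      {x : Fin 2 → ℝ | 0 < x 0 ∧ 0 < x 1 ∧ x 0 < 3 - x 0 - x 1 ∧ x 1 < 3 - x 0 - x 1} ⊆
      triangle := fun x hx => hEt (Or.inr hx)
  have h2t : {x : Fin 2 → ℝ | 0 < 3 - x 0 - x 1 ∧ 0 < x 0 ∧ 3 - x 0 - x 1 < x 1 ∧ x 0 < x 1} ⊆
      triangle := fun x hx => h23t (Or.inl hx)
  have h3t : {x : Fin 2 → ℝ | 0 < x 0 ∧ 0 < x 1 ∧ x 0 < 3 - x 0 - x 1 ∧ x 1 < 3 - x 0 - x 1} ⊆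
      triangle := fun x hx => h23t (Or.inr hx)
  -- the representations
  set R : IntegralRep 2 := simplexRep s hs with hR
  set RE : IntegralRep 2 := R.restrict _ hE hEt with hRE
  set R₁ : IntegralRep 2 := R.restrict _ h1 h1t with hR₁
  set R₂₃ : IntegralRep 2 := R.restrict _ h23 h23t with hR₂₃
  set R₂ : IntegralRep 2 := R.restrict _ h2 h2t with hR₂
  set R₃ : IntegralRep 2 := R.restrict _ h3 h3t with hR₃
  set R₃' : IntegralRep 2 := R₃.constMul ((3 : ℕ) : ℝ) (isAlgebraic_nat 3) with hR₃'
  -- move 1: drop the null mirror segments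
  have e1 : of R - of RE ∈ relations :=
    R.of_sub_of_restrict_mem_relations hE hEt volume_triangle_diff_cells
  -- moves 2, 3: domain additivity (the cells are pairwise disjoint)
  have e2 : of RE - of R₁ - of R₂₃ ∈ relations := by
    refine domainAddRel_subset_relations ⟨2, RE, R₁, R₂₃, rfl, ?_, fun _ _ => rfl, fun _ _ => rfl, rfl⟩
    have h : R₁.domain ∩ R₂₃.domain = ∅ := by
      ext x
      simp only [hR₁, hR₂₃, IntegralRep.domain_restrict, mem_inter_iff, mem_union, mem_setOf_eq,
        mem_empty_iff_false, iff_false]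
      rintro ⟨⟨_, _, ha, hb⟩, ⟨_, _, _, hc⟩ | ⟨_, _, hc, _⟩⟩ <;> linarith
    rw [h, measure_empty]
  have e3 : of R₂₃ - of R₂ - of R₃ ∈ relations := by
    refine domainAddRel_subset_relations ⟨2, R₂₃, R₂, R₃, rfl, ?_, fun _ _ => rfl, fun _ _ => rfl, rfl⟩
    have h : R₂.domain ∩ R₃.domain = ∅ := by
      ext x
      simp only [hR₂, hR₃, IntegralRep.domain_restrict, mem_inter_iff, mem_setOf_eq,
        mem_empty_iff_false, iff_false]
      rintro ⟨⟨_, _, ha, _⟩, ⟨_, _, _, hb⟩⟩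
      linarith
    rw [h, measure_empty]
  -- moves 4, 5: the cyclic changes of variables `M₂ → M₁`, `M₁ → M₃`
  have e4 : of R₂ - of R₁ ∈ relations :=
    changeOfVariablesRel_subset_relations
      (of_restrict_sub_of_restrict_mem_changeOfVariablesRel hs h2 h2t h1 h1t image_cyc_cellTwo)
  have e5 : of R₁ - of R₃ ∈ relations :=
    changeOfVariablesRel_subset_relations
      (of_restrict_sub_of_restrict_mem_changeOfVariablesRel hs h1 h1t h3 h3t image_cyc_cellOne)
  -- move 6: `[M₃, 3g] ∼ 3•[M₃, g]`
  have e6 : of R₃' - 3 • of R₃ ∈ relations := R₃.of_constMul_nat_sub_nsmul_mem_relations 3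
  have hchain : of R - of R₃' ∈ relations := mem_of_chain relations e1 e2 e3 e4 e5 e6
  -- congruences with the given representations
  have hr₀ : of r - of R ∈ relations :=
    of_sub_of_mem_relations_of_eqOn (by rw [hr]; rfl) hri
  have hr₁ : of R₃' - of r' ∈ relations := by
    refine of_sub_of_mem_relations_of_eqOn (by rw [hr']; rfl) fun x hx => ?_
    have hx' : x ∈ r'.domain := by rw [hr']; exact hx
    rw [hri' hx']
    show ((3 : ℕ) : ℝ) * simplexFun s x = 3 * (x 0 * x 1 * (3 - x 0 - x 1)) ^ ((s:ℝ) - 1)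
    rw [Nat.cast_ofNat]
    rfl
  have : of r - of r' = (of r - of R) + (of R - of R₃') + (of R₃' - of r') := by abel
  show of r - of r' ∈ relations
  rw [this]
  exact relations.add_mem (relations.add_mem hr₀ hchain) hr₁

end Summit.KontsevichZagierPeriods.TerasomaMultiplication.SimplexToMaxCell

end
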